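import Mathlib
import Summits.NavierStokesRegularity.NavierStokesRegularity.Theses.PicardRadiiRungThree
import HarnessLib

/-!
# `PicardRadiiRungThree.Assembly` — the route's assembly (item stmt-NavierStokesRegularity-23565; pure logic)

**Statement.** `PicardRadiiCertificate → RadiiGlue → TailEnvelopes → TransferBootstrap →
RestartControl → RestartGlue → LocalDynamicsSufficesAt → TaoLadderRungThree.Target`.

PROOF. The route file carries the planner-authored, kernel-checked deciding theorem
`Theses.PicardRadiiRungThree.closes` with exactly these hypotheses; the assembly is its curried
form. An IMPLICATION only: the hypotheses (among them the open certificate crux) remain hypotheses.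

HONEST FRAMING: pure logic between the route's own statements about a Tao-type MODEL lattice rung;
nothing about Navier–Stokes.
-/

noncomputable section

set_option linter.dupNamespace false

namespace Summit.NavierStokesRegularity.NavierStokesRegularity.Theorems

open Summit.NavierStokesRegularity.NavierStokesRegularity.Theses.PicardRadiiRungThree in
/-- **Item stmt-NavierStokesRegularity-23565** (`PicardRadiiRungThree.Assembly`): the route's items imply
the rung `TaoLadderRungThree.Target`, by the route file's deciding theorem `closes` (an implication;
its hypotheses stay hypotheses). [this file] -/
theorem picardRadiiRungThree_assembly_proof :
    Summit.NavierStokesRegularity.NavierStokesRegularity.Theses.PicardRadiiRungThree.Assembly := by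
  unfold Summit.NavierStokesRegularity.NavierStokesRegularity.Theses.PicardRadiiRungThree.Assembly
  intro h₁ hG h₂ h₃ h₄ h₅ h₆
  -- buildfix (bf3-g27, 2026-08-28): the route's `closes` was re-keyed (≈00:0xZ) to the `…R` items
  -- (PicardRadiiCertificateR / RadiiGlueR / TransferBootstrapR); this CLOSED assembly item keeps its accepted
  -- v1 statement. The v1 glue/bootstrap `h₃ (hG h₁) h₂` yields the same witness tuple, so the chain of
  -- `closes` is inlined verbatim. Statement byte-identical.
  obtain ⟨ε₀, R, θ, c, η, i₀, α, X₀, P, env, hε₁, hR, hθ0, hθ, hc, hη, hα, hX₀, hP, hstep⟩ := h₃ (hG h₁) h₂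
  have hε₀ : 0 < ε₀ := by rw [hε₁]; exact one_pos
  have hdyn : Literature.Analysis.FluidPDE.TaoCascade.DynamicsLocalAt ε₀ R := by
    refine ⟨θ, c, i₀, α, X₀, P, Literature.Analysis.FluidPDE.TaoCascade.epochEnvelope env,
      hθ0, by linarith, hc, hα, hX₀, hP, ?_⟩
    intro K₁ K₂ hK₁ hK₂
    obtain ⟨N₀, hN₀⟩ := h₄ ε₀ θ c η i₀ α X₀ P env K₁ K₂ hε₀ hθ hc.le hη hX₀ hK₁ hK₂
    refine ⟨N₀, fun n₀ hn₀ T hT X E hsol N hN t e hcp hhor => ?_⟩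
    have heN : 0 < e N := hcp.e_pos N hN le_rfl
    have hpow : 0 < (1 + ε₀) ^ ((5 : ℝ) * N / 2) := Real.rpow_pos_of_pos (by linarith) _
    have hγ : 0 < e N * (1 + ε₀) ^ ((5 : ℝ) * N / 2) := mul_pos heN hpow
    have hneg : (1 + ε₀) ^ (-(5 : ℝ) * N / 2) = ((1 + ε₀) ^ ((5 : ℝ) * N / 2))⁻¹ := by
      rw [← Real.rpow_neg (by linarith : (0 : ℝ) ≤ 1 + ε₀)]
      congr 1
      ring
    have hcγ : c * (1 + ε₀) ^ (-(5 : ℝ) * N / 2) * (e N)⁻¹ =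
        c / (e N * (1 + ε₀) ^ ((5 : ℝ) * N / 2)) := by
      rw [hneg]
      field_simp
    rw [hcγ] at hhor
    have hdiv : 0 < c / (e N * (1 + ε₀) ^ ((5 : ℝ) * N / 2)) := div_pos hc hγ
    have htN : t N < T := by linarith
    have hτ : c ≤ (T - t N) * (e N * (1 + ε₀) ^ ((5 : ℝ) * N / 2)) := by
      have h2 : c / (e N * (1 + ε₀) ^ ((5 : ℝ) * N / 2)) ≤ T - t N := by linarith
      have h3 := mul_le_mul_of_nonneg_right h2 hγ.le
      rwa [div_mul_cancel₀ c hγ.ne'] at h3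
    obtain ⟨hflow, hslack⟩ := hN₀ n₀ hn₀ T hT X E hsol N hN t e hcp htN
    obtain ⟨τ₁, a, hst⟩ :=
      hstep (N - n₀).toNat _ _ _ (hcp.state N hN le_rfl) hslack _ hτ _ _ hflow
    exact ⟨_, _, h₅ ε₀ θ c 4 i₀ n₀ X₀ _ _ N X E t e τ₁ a hε₀ hN hcp hst⟩
  rw [hε₁] at hdyn
  obtain ⟨α', X₀', hα', hng⟩ := h₆ 1 R one_pos hR hdyn
  exact ⟨R, hR, α', X₀', hα', hng⟩

end Summit.NavierStokesRegularity.NavierStokesRegularity.Theorems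

end
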